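import Literature.NumberTheory.PAdicHodge.BdRField
import Literature.NumberTheory.PAdicHodge.BdRPlusEmbedding
import Literature.NumberTheory.PAdicHodge.FontaineThetaNaturality
import Literature.NumberTheory.PAdicHodge.BdRPlusGalois
import Literature.AlgebraicGeometry.Resolution.AdicQuotient
import HarnessLib

/-!
# Base change of `𝔸_inf`, `θ[1/p]`, `B_dR⁺` and `B_dR = Frac B_dR⁺` along `𝒪_{ℂ_K} ≃ 𝒪_{ℂ_L}`

Fontaine's construction `𝒪 ↦ 𝔸_inf(𝒪) = 𝕎(𝒪♭) ↦ 𝔸_inf(𝒪)[1/p] ↦ B_dR⁺(𝒪) = (𝔸_inf(𝒪)[1/p])^_{ker θ[1/p]}`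
(Mathlib `BDeRhamPlus 𝒪 p`) only uses the ring `𝒪` (`p`-adically complete, `p` not a unit), so it
is functorial in `𝒪` (Fontaine 1994, Exp. II §1.2 and §1.5; Brinon–Conrad 2009, p. 80, before
Prop. 6.3.8: "the construction of `B_dR⁺` … only depends on `𝒪_{ℂ_K}` endowed with its
`G_K`-action"; Fontaine–Ouyang §5.1–5.2).  The tree transports a single automorphism `σ ∈ Γ_F` of
`𝒪_{ℂ_F}` through the construction (`galAinf`, `galAinfLoc`, `galBdRPlus`, files
`FontaineThetaGalois`, `BdRPlusGalois`); this file does the same for a ring homomorphism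
`f : 𝒪 → 𝒪'` between two rings, reusing the functoriality of the tilt (`tiltMap`, naturality of
`θ`: `fontaineTheta_map_tiltMap`, file `FontaineThetaNaturality`) and of adic completions
(`adicCompletionMap`, file `AlgebraicGeometry/Resolution/AdicQuotient`):

* `map_tiltMap_comp_apply`, `map_tiltMap_id_apply` : functoriality of `𝒪 ↦ 𝕎(𝒪♭)`;
* `fontaineThetaInvertP_map` : **naturality of `θ[1/p]`**,
  `θ_{𝒪'}[1/p] ∘ 𝕎(f♭)[1/p] = f[1/p] ∘ θ_𝒪[1/p]`; hence `𝕎(f♭)[1/p]` maps `ker θ_𝒪[1/p]` into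
  `ker θ_{𝒪'}[1/p]` (`map_ker_fontaineThetaInvertP_le`);
* `bdRPlusMap_of`, `bdRPlusMap_comp_apply`, `bdRPlusMap_id_apply`, `bdRPlusMap_congr`,
  `bdRPlusMap_comp_eq_id` : the induced ring homomorphism `B_dR⁺(f) : B_dR⁺(𝒪) → B_dR⁺(𝒪')`, written
  out as `adicCompletionMap _ _ _ (map_ker_fontaineThetaInvertP_le p f)` (tree `adicCompletionMap`
  along `𝕎(f♭)[1/p]`; no new definition is introduced), extends `𝕎(f♭)[1/p]`, is functorial, and
  is invertible when `f` is;
* for nonarchimedean local fields `K`, `L` (hypotheses, as instances: `ℓ` is not a unit of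
  `𝒪_{ℂ_K}`, `𝒪_{ℂ_L}`, which are `ℓ`-adically complete — both follow from `v(ℓ) < 1`, file
  `FontaineThetaLocalField`): `galBdRPlus_eq_bdRPlusMap` (the tree's `galBdRPlus σ` is
  `B_dR⁺(galInt σ)`), `bdRPlusMap_galBdRPlus` (**equivariance**: `B_dR⁺(f) ∘ galBdRPlus (res τ) =
  galBdRPlus τ ∘ B_dR⁺(f)` as soon as `f ∘ galInt (res τ) = galInt τ ∘ f`, `res = absGaloisRestrict K L`),
  `bdRPlusMap_ainfToBdR`, `bdRPlusMap_qpToBdR` (`B_dR⁺(f)` is the identity on `ℚ_ℓ ⊆ B_dR⁺`,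
  `qpToBdR`, file `BdRPlusEmbedding`);
* `exists_fracBdR_ringEquiv` : for a ring isomorphism `g : 𝒪_{ℂ_K} ≃ 𝒪_{ℂ_L}` with
  `g ∘ galInt (res τ) = galInt τ ∘ g`, **there is a ring isomorphism `Φ : B_dR(K) ≃ B_dR(L)`** of
  `B_dR = Frac B_dR⁺` (`FracBdR`, file `BdRField`) with `Φ (res τ • b) = τ • Φ b` and `Φ = id` on
  `ℚ_ℓ`: `Φ = Frac (B_dR⁺(g))` with inverse `Frac (B_dR⁺(g⁻¹))`.  This is the functoriality input
  of Brinon–Conrad Prop. 6.3.8 (the de Rham property is insensitive to a finite extension of the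
  base field).

NOT here: the compatibility of `Φ` with the filtrations `Fil^i = ξ^i B_dR⁺` or with `θ` (not needed
by the consumer), and the construction of `g` (file `CompletedAlgClosureBaseChange`).

## References
* [FontaineAsterisque223III] J.-M. Fontaine, *Le corps des périodes p-adiques*, Astérisque 223
  (1994), Exp. II, §1.2 and §1.5.
* [BrinonConrad2009] O. Brinon, B. Conrad, *CMI Summer School notes on p-adic Hodge theory*
  (2009), p. 80 (discussion before Prop. 6.3.8) and Prop. 6.3.8.
* [FontaineOuyang2022] J.-M. Fontaine, Y. Ouyang, *Theory of p-adic Galois representations*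
  (book draft), §5.1–§5.2.
-/

noncomputable section

open Field ValuativeRel Ideal WittVector
open Literature.AlgebraicGeometry.Resolution

namespace Literature.NumberTheory.PAdicHodge

open Literature.NumberTheory.GaloisRepresentations
open Literature.NumberTheory.GaloisRepresentations.IsNonarchimedeanLocalField

universe u

/-! ### Localisation away from `p` is functorial -/

section Loc

variable {A B : Type*} [CommRing A] [CommRing B] (p : ℕ)

/-- A ring homomorphism maps the powers of `p` into the powers of `p`. [folklore] -/
theorem powers_natCast_le_comap (φ : A →+* B) :
    Submonoid.powers (p : A) ≤ (Submonoid.powers (p : B)).comap φ := by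
  rintro _ ⟨n, rfl⟩
  exact ⟨n, by rw [map_pow, map_natCast]⟩

/-- The induced map `A[1/p] → B[1/p]` only depends on the ring map (proof-irrelevance helper).
[folklore] -/
theorem locAway_map_congr {φ₁ φ₂ : A →+* B} (h : φ₁ = φ₂)
    (h₁ : Submonoid.powers (p : A) ≤ (Submonoid.powers (p : B)).comap φ₁)
    (h₂ : Submonoid.powers (p : A) ≤ (Submonoid.powers (p : B)).comap φ₂)
    (x : Localization.Away (p : A)) :
    IsLocalization.map (Localization.Away (p : B)) φ₁ h₁ x =
      IsLocalization.map (Localization.Away (p : B)) φ₂ h₂ x := by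
  subst h; rfl

end Loc

/-! ### Functoriality of `𝒪 ↦ 𝕎(𝒪♭)`, `θ[1/p]`, `B_dR⁺(𝒪)` in the ring `𝒪`

Throughout, for a ring homomorphism `f : 𝒪 → 𝒪'`: `𝕎(f♭)` is `WittVector.map (p := p) (tiltMap p f)`;
`𝕎(f♭)[1/p] : 𝕎(𝒪♭)[1/p] → 𝕎(𝒪'♭)[1/p]` is Mathlib's `IsLocalization.map _ (𝕎(f♭)) _`; and
**`B_dR⁺(f) : B_dR⁺(𝒪) → B_dR⁺(𝒪')` is `adicCompletionMap _ _ _ (map_ker_fontaineThetaInvertP_le p f)`**,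
the map of `ker θ[1/p]`-adic completions induced by `𝕎(f♭)[1/p]` (all its other arguments are
determined by the last one). No new definition is introduced. -/

section Perfectoid

variable {O O' O'' : Type u} [CommRing O] [CommRing O'] [CommRing O''] {p : ℕ} [Fact p.Prime]
  [Fact (¬ IsUnit (p : O))] [Fact (¬ IsUnit (p : O'))] [Fact (¬ IsUnit (p : O''))]

/-- `𝕎((f' ∘ f)♭) = 𝕎(f'♭) ∘ 𝕎(f♭)` on `𝕎(𝒪♭)`. [folklore] -/
theorem map_tiltMap_comp_apply (f : O →+* O') (f' : O' →+* O'') (x : WittVector p (PreTilt O p)) :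
    WittVector.map (p := p) (tiltMap p (f'.comp f)) x =
      WittVector.map (p := p) (tiltMap p f') (WittVector.map (p := p) (tiltMap p f) x) := by
  refine WittVector.ext fun n => ?_
  rw [WittVector.map_coeff, WittVector.map_coeff, WittVector.map_coeff, tiltMap_comp_apply]

/-- `𝕎(id♭) = id` on `𝕎(𝒪♭)`. [folklore] -/
theorem map_tiltMap_id_apply (x : WittVector p (PreTilt O p)) :
    WittVector.map (p := p) (tiltMap p (RingHom.id O)) x = x := by
  refine WittVector.ext fun n => ?_
  rw [WittVector.map_coeff, tiltMap_id_apply]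

variable [IsAdicComplete (Ideal.span {(p : O)}) O] [IsAdicComplete (Ideal.span {(p : O')}) O']
  [IsAdicComplete (Ideal.span {(p : O'')}) O'']

/-- `θ[1/p]` extends `θ` (ring version of `fontaineThetaInvertP_algebraMap`). [folklore] -/
theorem fontaineThetaInvertP_apply_algebraMap (x : WittVector p (PreTilt O p)) :
    fontaineThetaInvertP O p
        (algebraMap _ (Localization.Away (p : WittVector p (PreTilt O p))) x) =
      algebraMap O (Localization.Away (p : O)) (fontaineTheta O p x) := by
  delta fontaineThetaInvertP
  exact IsLocalization.Away.lift_eq (p : WittVector p (PreTilt O p)) _ x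

/-- **Naturality of `θ[1/p]`**: `θ_{𝒪'}[1/p] ∘ 𝕎(f♭)[1/p] = f[1/p] ∘ θ_𝒪[1/p]` (from the naturality
of `θ`, `fontaineTheta_map_tiltMap`, by the universal property of `𝕎(𝒪♭)[1/p]`).
[cite: FontaineAsterisque223III, Exp. II §1.5] -/
theorem fontaineThetaInvertP_map (f : O →+* O')
    (x : Localization.Away (p : WittVector p (PreTilt O p))) :
    fontaineThetaInvertP O' p
        (IsLocalization.map (Localization.Away (p : WittVector p (PreTilt O' p)))
          (WittVector.map (p := p) (tiltMap p f)) (powers_natCast_le_comap p _) x) =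
      IsLocalization.map (Localization.Away (p : O')) f (powers_natCast_le_comap p f)
        (fontaineThetaInvertP O p x) := by
  have h : (fontaineThetaInvertP O' p).comp
        (IsLocalization.map (S := Localization.Away (p : WittVector p (PreTilt O p)))
          (Localization.Away (p : WittVector p (PreTilt O' p))) (WittVector.map (p := p) (tiltMap p f))
          (powers_natCast_le_comap p _)) =
      (IsLocalization.map (S := Localization.Away (p : O)) (Localization.Away (p : O')) f
        (powers_natCast_le_comap p f)).comp (fontaineThetaInvertP O p) := by
    refine IsLocalization.ringHom_ext (Submonoid.powers (p : WittVector p (PreTilt O p)))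
      (RingHom.ext fun y => ?_)
    simp only [RingHom.comp_apply, IsLocalization.map_eq, fontaineThetaInvertP_apply_algebraMap,
      fontaineTheta_map_tiltMap]
  exact RingHom.congr_fun h x

variable (p) in
/-- **`𝕎(f♭)[1/p]` maps `ker θ_𝒪[1/p]` into `ker θ_{𝒪'}[1/p]`.**
[cite: FontaineAsterisque223III, Exp. II §1.5] -/
theorem map_ker_fontaineThetaInvertP_le (f : O →+* O') :
    (RingHom.ker (fontaineThetaInvertP O p)).map
        (IsLocalization.map (S := Localization.Away (p : WittVector p (PreTilt O p)))
          (Localization.Away (p : WittVector p (PreTilt O' p))) (WittVector.map (p := p) (tiltMap p f))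
          (powers_natCast_le_comap p _)) ≤
      RingHom.ker (fontaineThetaInvertP O' p) := by
  rw [Ideal.map_le_iff_le_comap]
  intro x hx
  rw [Ideal.mem_comap, RingHom.mem_ker, fontaineThetaInvertP_map, RingHom.mem_ker.1 hx,
    _root_.map_zero]

/-- **`B_dR⁺(f) : B_dR⁺(𝒪) → B_dR⁺(𝒪')` extends `𝕎(f♭)[1/p]`** along `𝔸_inf[1/p] → B_dR⁺`, where
`B_dR⁺(f) = adicCompletionMap _ _ _ (map_ker_fontaineThetaInvertP_le p f)` is the map of
`ker θ[1/p]`-adic completions induced by `𝕎(f♭)[1/p]`. [cite: FontaineAsterisque223III, Exp. II §1.5]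
[cite: BrinonConrad2009, Prop. 6.3.8] -/
theorem bdRPlusMap_of (f : O →+* O') (x : Localization.Away (p : WittVector p (PreTilt O p))) :
    adicCompletionMap _ _ _ (map_ker_fontaineThetaInvertP_le p f) (AdicCompletion.of _ _ x) =
      AdicCompletion.of _ _ (IsLocalization.map (Localization.Away (p : WittVector p (PreTilt O' p)))
        (WittVector.map (p := p) (tiltMap p f)) (powers_natCast_le_comap p _) x) :=
  adicCompletionMap_of _ _ _ _ x

/-- **Functoriality of `B_dR⁺`**: `B_dR⁺(f') ∘ B_dR⁺(f) = B_dR⁺(f' ∘ f)`.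
[cite: BrinonConrad2009, Prop. 6.3.8] -/
theorem bdRPlusMap_comp_apply (f : O →+* O') (f' : O' →+* O'') (x : BDeRhamPlus O p) :
    adicCompletionMap _ _ _ (map_ker_fontaineThetaInvertP_le p f')
        (adicCompletionMap _ _ _ (map_ker_fontaineThetaInvertP_le p f) x) =
      adicCompletionMap _ _ _ (map_ker_fontaineThetaInvertP_le p (f'.comp f)) x := by
  rw [adicCompletionMap_comp]
  refine adicCompletionMap_congr _ _ ?_ _ _ x
  rw [IsLocalization.map_comp_map]
  exact RingHom.ext fun y =>
    locAway_map_congr p (RingHom.ext fun z => (map_tiltMap_comp_apply f f' z).symm) _ _ y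

omit [Fact (¬ IsUnit (p : O'))] [IsAdicComplete (Ideal.span {(p : O')}) O'] in
/-- `B_dR⁺(id) = id`. [folklore] -/
theorem bdRPlusMap_id_apply (x : BDeRhamPlus O p) :
    adicCompletionMap _ _ _ (map_ker_fontaineThetaInvertP_le p (RingHom.id O)) x = x := by
  have h : IsLocalization.map (S := Localization.Away (p : WittVector p (PreTilt O p)))
      (Localization.Away (p : WittVector p (PreTilt O p)))
      (WittVector.map (p := p) (tiltMap p (RingHom.id O))) (powers_natCast_le_comap p _) =
      RingHom.id _ :=
    IsLocalization.ringHom_ext (Submonoid.powers (p : WittVector p (PreTilt O p)))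
      (RingHom.ext fun y => by rw [RingHom.comp_apply, IsLocalization.map_eq, map_tiltMap_id_apply]; rfl)
  rw [adicCompletionMap_congr _ _ h _ (by simp), adicCompletionMap_id]

/-- `B_dR⁺(f)` only depends on `f` (congruence helper). [folklore] -/
theorem bdRPlusMap_congr {f₁ f₂ : O →+* O'} (h : f₁ = f₂) (x : BDeRhamPlus O p) :
    adicCompletionMap _ _ _ (map_ker_fontaineThetaInvertP_le p f₁) x =
      adicCompletionMap _ _ _ (map_ker_fontaineThetaInvertP_le p f₂) x := by
  subst h; rfl

/-- A left inverse `f'` of `f` induces a left inverse `B_dR⁺(f')` of `B_dR⁺(f)`. [folklore] -/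
theorem bdRPlusMap_apply_apply_of_comp_eq_id {f : O →+* O'} {f' : O' →+* O}
    (h : f'.comp f = RingHom.id O) (x : BDeRhamPlus O p) :
    adicCompletionMap _ _ _ (map_ker_fontaineThetaInvertP_le p f')
      (adicCompletionMap _ _ _ (map_ker_fontaineThetaInvertP_le p f) x) = x :=
  (bdRPlusMap_comp_apply f f' x).trans ((bdRPlusMap_congr h x).trans (bdRPlusMap_id_apply x))

/-- `B_dR⁺(f') ∘ B_dR⁺(f) = id` if `f' ∘ f = id` (ring-homomorphism form). [folklore] -/
theorem bdRPlusMap_comp_eq_id {f : O →+* O'} {f' : O' →+* O} (h : f'.comp f = RingHom.id O) :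
    (adicCompletionMap _ _ _ (map_ker_fontaineThetaInvertP_le p f')).comp
        (adicCompletionMap _ _ _ (map_ker_fontaineThetaInvertP_le p f)) =
      RingHom.id (BDeRhamPlus O p) :=
  RingHom.ext fun x => bdRPlusMap_apply_apply_of_comp_eq_id h x

end Perfectoid

/-! ### Local fields: `B_dR(K) ≃ B_dR(L)` along `𝒪_{ℂ_K} ≃ 𝒪_{ℂ_L}` -/

section LocalField

variable {K L : Type} [Field K] [ValuativeRel K] [TopologicalSpace K] [IsNonarchimedeanLocalField K]
  [CharZero K] [Field L] [ValuativeRel L] [TopologicalSpace L] [IsNonarchimedeanLocalField L]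
  [CharZero L] [Algebra K L] {ℓ : ℕ} [Fact ℓ.Prime]
  [Fact (¬ IsUnit ((ℓ : ℕ) : integerC K))] [IsAdicComplete (Ideal.span {((ℓ : ℕ) : integerC K)}) (integerC K)]
  [Fact (¬ IsUnit ((ℓ : ℕ) : integerC L))] [IsAdicComplete (Ideal.span {((ℓ : ℕ) : integerC L)}) (integerC L)]

/-- The tree's `galBdRPlus σ` (`σ ∈ Γ_K` acting on `B_dR⁺(K)`) is `B_dR⁺(galInt σ)`: both are the
completion of the localisation of `𝕎((galInt σ)♭)`. [folklore] -/
theorem galBdRPlus_eq_bdRPlusMap (σ : absoluteGaloisGroup K) (x : BDeRhamPlus (integerC K) ℓ) :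
    galBdRPlus σ x = adicCompletionMap _ _ _ (map_ker_fontaineThetaInvertP_le ℓ (galInt σ)) x := rfl

omit [CharZero K] [CharZero L] [Algebra K L]
  [IsAdicComplete (Ideal.span {((ℓ : ℕ) : integerC K)}) (integerC K)]
  [IsAdicComplete (Ideal.span {((ℓ : ℕ) : integerC L)}) (integerC L)] in
/-- `𝕎(f♭) ∘ (ℤ_ℓ → 𝔸_inf(K)) = (ℤ_ℓ → 𝔸_inf(L))` (uniqueness of ring maps out of `ℤ_ℓ` into the
`ℓ`-adically separated ring `𝔸_inf(L)`). [folklore] -/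
theorem map_tiltMap_zpToAinf (f : integerC K →+* integerC L) (y : ℤ_[ℓ]) :
    WittVector.map (p := ℓ) (tiltMap ℓ f) (zpToAinf y : Ainf (p := ℓ) K) = (zpToAinf y : Ainf (p := ℓ) L) :=
  RingHom.congr_fun (padicInt_ringHom_ext_of_isHausdorff
    ((WittVector.map (p := ℓ) (tiltMap ℓ f)).comp zpToAinf) zpToAinf) y

/-- **`B_dR⁺(f)` is equivariant** for a ring homomorphism `f : 𝒪_{ℂ_K} → 𝒪_{ℂ_L}` intertwining
`galInt (res τ)` and `galInt τ` (`res = absGaloisRestrict K L`):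
`B_dR⁺(f) ∘ galBdRPlus (res τ) = galBdRPlus τ ∘ B_dR⁺(f)` (functoriality of `B_dR⁺`, as
`galBdRPlus σ = B_dR⁺(galInt σ)`). [cite: BrinonConrad2009, Prop. 6.3.8] -/
theorem bdRPlusMap_galBdRPlus (f : integerC K →+* integerC L)
    (hf : ∀ (τ : absoluteGaloisGroup L) (x : integerC K),
      f (galInt (absGaloisRestrict K L τ) x) = galInt τ (f x))
    (τ : absoluteGaloisGroup L) (b : BDeRhamPlus (integerC K) ℓ) :
    adicCompletionMap _ _ _ (map_ker_fontaineThetaInvertP_le ℓ f) (galBdRPlus (absGaloisRestrict K L τ) b) =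
      galBdRPlus τ (adicCompletionMap _ _ _ (map_ker_fontaineThetaInvertP_le ℓ f) b) :=
  ((bdRPlusMap_comp_apply (galInt (absGaloisRestrict K L τ)) f b).trans
    (bdRPlusMap_congr (RingHom.ext fun x => hf τ x) b)).trans
    (bdRPlusMap_comp_apply f (galInt τ) b).symm

omit [CharZero K] [CharZero L] [Algebra K L] in
/-- `B_dR⁺(f) ∘ (𝔸_inf(K) → B_dR⁺(K)) = (𝔸_inf(L) → B_dR⁺(L)) ∘ 𝕎(f♭)`. [folklore] -/
theorem bdRPlusMap_ainfToBdR (f : integerC K →+* integerC L) (x : Ainf (p := ℓ) K) :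
    adicCompletionMap _ _ _ (map_ker_fontaineThetaInvertP_le ℓ f) (ainfToBdR x) =
      ainfToBdR (WittVector.map (p := ℓ) (tiltMap ℓ f) x) :=
  (bdRPlusMap_of f _).trans (congrArg (AdicCompletion.of _ _)
    (IsLocalization.map_eq (powers_natCast_le_comap ℓ (WittVector.map (p := ℓ) (tiltMap ℓ f))) x))

omit [CharZero K] [CharZero L] [Algebra K L] in
/-- **`B_dR⁺(f)` is the identity on `ℚ_ℓ ⊆ B_dR⁺`**: both `B_dR⁺(f) ∘ (ℚ_ℓ → B_dR⁺(K))` and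
`ℚ_ℓ → B_dR⁺(L)` are ring maps out of `ℚ_ℓ = Frac ℤ_ℓ` agreeing on `ℤ_ℓ` (`map_tiltMap_zpToAinf`).
[folklore] -/
theorem bdRPlusMap_qpToBdR (f : integerC K →+* integerC L) (q : ℚ_[ℓ]) :
    adicCompletionMap _ _ _ (map_ker_fontaineThetaInvertP_le ℓ f) (qpToBdR (F := K) (p := ℓ) q) =
      qpToBdR (F := L) (p := ℓ) q := by
  have h : (adicCompletionMap _ _ _ (map_ker_fontaineThetaInvertP_le ℓ f)).comp
      (qpToBdR (F := K) (p := ℓ)) = qpToBdR (F := L) (p := ℓ) :=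
    IsLocalization.ringHom_ext (nonZeroDivisors ℤ_[ℓ]) (RingHom.ext fun y =>
      show adicCompletionMap _ _ _ (map_ker_fontaineThetaInvertP_le ℓ f) (qpToBdR (y : ℚ_[ℓ])) =
          qpToBdR (y : ℚ_[ℓ]) from
        (congrArg (adicCompletionMap _ _ _ (map_ker_fontaineThetaInvertP_le ℓ f)) (qpToBdR_coe y)).trans
          (((bdRPlusMap_ainfToBdR f _).trans (congrArg ainfToBdR (map_tiltMap_zpToAinf f y))).trans
            (qpToBdR_coe y).symm))
  exact RingHom.congr_fun h q

/-- **`B_dR(K) ≃ B_dR(L)` along an equivariant isomorphism `𝒪_{ℂ_K} ≃ 𝒪_{ℂ_L}`.**  Let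
`g : 𝒪_{ℂ_K} ≃+* 𝒪_{ℂ_L}` satisfy `g (galInt (res τ) x) = galInt τ (g x)` for all `τ ∈ Γ_L`, where
`res = absGaloisRestrict K L`.  Then `B_dR⁺(g)` is a ring isomorphism `B_dR⁺(K) ≃ B_dR⁺(L)` (inverse
`B_dR⁺(g⁻¹)`, by functoriality) with `B_dR⁺(g) ∘ galBdRPlus (res τ) = galBdRPlus τ ∘ B_dR⁺(g)`
(`bdRPlusMap_galBdRPlus`) and `B_dR⁺(g)|_{ℚ_ℓ} = id` (`bdRPlusMap_qpToBdR`), and its extension `Φ`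
to the fraction fields `B_dR = Frac B_dR⁺` (Mathlib `IsFractionRing.ringEquivOfRingEquiv`)
satisfies `Φ (res τ • b) = τ • Φ b` and fixes `ℚ_ℓ` (both sides of each identity are ring
homomorphisms out of `Frac B_dR⁺(K)` agreeing on `B_dR⁺(K)`).  Brinon–Conrad p. 80: "the
construction of `B_dR⁺` … only depends on `𝒪_{ℂ_K}` endowed with its `G_K`-action".
[cite: BrinonConrad2009, Prop. 6.3.8] [cite: FontaineAsterisque223III, Exp. II §1.5] -/
theorem exists_fracBdR_ringEquiv (g : integerC K ≃+* integerC L)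
    (hg : ∀ (τ : absoluteGaloisGroup L) (x : integerC K),
      g (galInt (absGaloisRestrict K L τ) x) = galInt τ (g x)) :
    ∃ Φ : FracBdR K ℓ ≃+* FracBdR L ℓ,
      (∀ (τ : absoluteGaloisGroup L) (b : FracBdR K ℓ), Φ (absGaloisRestrict K L τ • b) = τ • Φ b) ∧
      ∀ q : ℚ_[ℓ], Φ (algebraMap (BDeRhamPlus (integerC K) ℓ) (FracBdR K ℓ) (qpToBdR q)) =
        algebraMap (BDeRhamPlus (integerC L) ℓ) (FracBdR L ℓ) (qpToBdR q) := by
  -- `Φp = B_dR⁺(g)`, an isomorphism with inverse `B_dR⁺(g⁻¹)`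
  obtain ⟨Φp, hΦp⟩ : ∃ Φp : BDeRhamPlus (integerC K) ℓ ≃+* BDeRhamPlus (integerC L) ℓ,
      ∀ x, Φp x = adicCompletionMap _ _ _ (map_ker_fontaineThetaInvertP_le ℓ g.toRingHom) x :=
    ⟨RingEquiv.ofRingHom (adicCompletionMap _ _ _ (map_ker_fontaineThetaInvertP_le ℓ g.toRingHom))
        (adicCompletionMap _ _ _ (map_ker_fontaineThetaInvertP_le ℓ g.symm.toRingHom))
        (bdRPlusMap_comp_eq_id (RingEquiv.toRingHom_comp_symm_toRingHom g))
        (bdRPlusMap_comp_eq_id (RingEquiv.symm_toRingHom_comp_toRingHom g)),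
      fun _ => rfl⟩
  have hgal : ∀ (τ : absoluteGaloisGroup L) (b : BDeRhamPlus (integerC K) ℓ),
      Φp (galBdRPlus (absGaloisRestrict K L τ) b) = galBdRPlus τ (Φp b) := fun τ b =>
    (hΦp _).trans ((bdRPlusMap_galBdRPlus g.toRingHom (fun τ x => hg τ x) τ b).trans
      (congrArg (galBdRPlus τ) (hΦp b).symm))
  have hqp : ∀ q : ℚ_[ℓ], Φp (qpToBdR q) = qpToBdR q := fun q =>
    (hΦp _).trans (bdRPlusMap_qpToBdR g.toRingHom q)
  -- `Φ = Frac Φp`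
  obtain ⟨Φ, hΦ⟩ : ∃ Φ : FracBdR K ℓ ≃+* FracBdR L ℓ, ∀ x,
      Φ (algebraMap (BDeRhamPlus (integerC K) ℓ) (FracBdR K ℓ) x) =
        algebraMap (BDeRhamPlus (integerC L) ℓ) (FracBdR L ℓ) (Φp x) :=
    ⟨IsFractionRing.ringEquivOfRingEquiv Φp, IsFractionRing.ringEquivOfRingEquiv_algebraMap Φp⟩
  refine ⟨Φ, fun τ b => ?_, fun q => (hΦ _).trans (congrArg (algebraMap _ (FracBdR L ℓ)) (hqp q))⟩
  have h : Φ.toRingHom.comp (MulSemiringAction.toRingHom (absoluteGaloisGroup K) (FracBdR K ℓ)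
        (absGaloisRestrict K L τ)) =
      (MulSemiringAction.toRingHom (absoluteGaloisGroup L) (FracBdR L ℓ) τ).comp Φ.toRingHom :=
    IsLocalization.ringHom_ext (nonZeroDivisors (BDeRhamPlus (integerC K) ℓ)) (RingHom.ext fun x =>
      show Φ (absGaloisRestrict K L τ • algebraMap _ (FracBdR K ℓ) x) =
          τ • Φ (algebraMap _ (FracBdR K ℓ) x) from
        (congrArg Φ (smul_algebraMap_fracBdR _ x)).trans <| (hΦ _).trans <|
          (congrArg (algebraMap _ (FracBdR L ℓ)) (hgal τ x)).trans <|
            (smul_algebraMap_fracBdR τ (Φp x)).symm.trans (congrArg (τ • ·) (hΦ x).symm))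
  exact RingHom.congr_fun h b

end LocalField

end Literature.NumberTheory.PAdicHodge

end
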